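import Summits.ABC.IUTFork.Cor312PilotKummerCompatLevels
import HarnessLib

/-!
# [IUTchIII] Cor. 3.12 — the INCLUSION form of `PilotKummerCompat` SUFFICES for the Statement, for any MONOTONE region operator

Record-only file (D-0012) of the abc-iut cell (WAVE-5 prover abc-iut-w5-d147, gen 3); PROOF-ONLY (0 definitions, 0 `Prop` facts);
TAKES NO SIDE on [IUTchIII] Cor. 3.12. Companion to abc-iut-w5-d068's `Cor312PilotKummerCompat` (p420303: print's Thm. 3.11 (iii) (c)
final clause p. 158 l. 5–14 read at the pilots at DATUM / REGION / HULL level, each ⟹ Statement under the pins) and to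
abc-iut-w5-d247's `Cor312PilotKummerCompatUnits` (p422787: the INCLUSION form `∃ Φ ∈ ⟨Ind1 ∪ Ind2⟩, ∃ m, ∀ v, qK_v ⊆ Φ·Ψ^{Frob}_{m,v}`,
inline, is STRICTLY between the datum (equality) form and the region-level residual over the naive model — units separate it from the
residual, torsion multiplicity from equality). p422787 derives the Statement from the inclusion form only INSIDE the naive family (via
the residual). THIS FILE supplies the GENERAL positive direction, for ANY lattice situation and setting:

* `pilotKummerCompatHull_of_subDatum`: the inclusion form + the Θ-pin (pΘ) (which carries (hρ)) + ONE extra inline hypothesis —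
  MONOTONICITY of PR-1's region operator `ρ` in the datum (`Ψ ⊆ Ψ′ ⟹ ρ Ψ ⊆ ρ Ψ′` packetwise) — give the HULL-level clause: the
  `ρ`-region of the q-pilot's Kummer datum lies inside ONE indeterminacy-translate of ONE Θ-pilot region, hence in `^{n,∘}𝒰_{j,v_ℚ}`;
  set equality is never used;
* `statement_of_subDatum` / `statement_of_thm311_of_pinned3_of_subDatum`: hence the printed Statement under `BridgeHyps` + the pins
  (abc-iut-c312-1's (xi-f) `Licence` route, as p420303), the typed Thm. 3.11 and the link pin carried, not consumed;
* `ballOfMonoid_mono`: abc-iut-w5-d230's honest operator of the naive model IS monotone, so (`subDatum_imp_statement_naive`) for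
  every `withQDatum` setting the inclusion form gives typed Cor. 3.12 by the general route (no residual, no Thm. 3.11 (ii) (b)).
Without monotonicity nothing is claimed (a non-monotone `ρ` may send a sub-datum anywhere). READING (neutral): with p420303 and
p422787, every typed form of the clause — equality, inclusion, region, hull — is SUFFICIENT for the Statement under the pins (the
inclusion form for monotone `ρ`), and exactly the region form is EQUIVALENT to the residual of record. Nothing here says which level
print intends. [claim: Mochizuki2012, status: disputed] [cite: ScholzeStix2018, §2.2 pp. 9–10] Standard axioms; typed ≠ proved.
-/

noncomputable section

open Set

namespace Summit.ABC.IUTFork.Cor312Vol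

open Thm311 Cor312 Literature.IUT.LogThetaLattice

/-! ## 1. General: INCLUSION form + monotone `ρ` + Θ-pin ⟹ HULL ⟹ Statement -/

section General

variable {T : ThetaIndex} (S : LatticeSituation T) (P : Cor312.Setting S.toSituation)
  (ρ : (∀ v : T.V, v ∈ T.Vbad → Set (S.L.StarPacket v)) → ∀ (j : T.Label) (vQ : T.VQ), Set (S.L.Packet j vQ))
  (qK : ∀ v : T.V, v ∈ T.Vbad → Set (S.L.StarPacket v))

/-- **INCLUSION form ⟹ HULL**: for a region operator `ρ` MONOTONE in the datum (inline hypothesis `hmono`) satisfying the Θ-pin (pΘ)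
(which carries (hρ)), the inclusion form of print's Kummer/link-compatibility clause puts the `ρ`-region of the q-pilot's Kummer datum
inside ONE indeterminacy-translate of ONE Θ-pilot region, hence inside the packet hull `^{n,∘}𝒰_{j,v_ℚ}`. [claim: Mochizuki2012, status: disputed] -/
theorem pilotKummerCompatHull_of_subDatum
    (hmono : ∀ (Ψ Ψ' : ∀ v : T.V, v ∈ T.Vbad → Set (S.L.StarPacket v)),
      (∀ (v : T.V) (hv : v ∈ T.Vbad), Ψ v hv ⊆ Ψ' v hv) → ∀ (j : T.Label) (vQ : T.VQ), ρ Ψ j vQ ⊆ ρ Ψ' j vQ)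
    (hΘ : ThetaPinned S P ρ)
    (hsub : ∃ Φ ∈ Subgroup.closure (S.L.Ind1Family ∪ S.L.Ind2Family), ∃ m : ℤ,
      ∀ (v : T.V) (hv : v ∈ T.Vbad), qK v hv ⊆ S.L.starAut Φ v '' (S.col P.n).frobΨ m v hv) :
    PilotKummerCompatHull S P ρ qK := fun j vQ => by
  obtain ⟨Φ, hΦ, m, hm⟩ := hsub
  have h1 : ρ qK j vQ ⊆ Φ j vQ '' P.thetaRegion m j vQ := by
    have h := hmono qK (fun v hv => S.L.starAut Φ v '' (S.col P.n).frobΨ m v hv) hm j vQ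
    rw [hΘ.1 Φ hΦ, ← hΘ.2 m j vQ] at h
    exact h
  refine h1.trans (Set.Subset.trans ?_ ((P.frame j vQ).subset_hull _))
  refine Set.Subset.trans (Set.image_mono (Set.subset_iUnion (fun m : ℤ => P.thetaRegion m j vQ) m)) ?_
  exact Set.subset_sUnion_of_mem ⟨Φ, hΦ, rfl⟩

/-- **`statement_of_subDatum`**: bridge hypotheses + the two region pins + monotone `ρ` + the INCLUSION form of the Kummer/link-
compatibility clause ⟹ the printed Statement of Cor. 3.12 (via abc-iut-w5-d068's `statement_of_pilotKummerCompatHull`, i.e.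
abc-iut-c312-1's (xi-f) `Licence`). [claim: Mochizuki2012, status: disputed] -/
theorem statement_of_subDatum (H : BridgeHyps P)
    (hmono : ∀ (Ψ Ψ' : ∀ v : T.V, v ∈ T.Vbad → Set (S.L.StarPacket v)),
      (∀ (v : T.V) (hv : v ∈ T.Vbad), Ψ v hv ⊆ Ψ' v hv) → ∀ (j : T.Label) (vQ : T.VQ), ρ Ψ j vQ ⊆ ρ Ψ' j vQ)
    (hpin : PinnedRegions S P ρ qK)
    (hsub : ∃ Φ ∈ Subgroup.closure (S.L.Ind1Family ∪ S.L.Ind2Family), ∃ m : ℤ,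
      ∀ (v : T.V) (hv : v ∈ T.Vbad), qK v hv ⊆ S.L.starAut Φ v '' (S.col P.n).frobΨ m v hv) :
    P.Statement :=
  statement_of_pilotKummerCompatHull S P ρ qK H hpin.2 (pilotKummerCompatHull_of_subDatum S P ρ qK hmono hpin.1 hsub)

/-- The same over the typed Theorem 3.11 and the THREE pins (its `Statement` and the link pin are carried, not consumed — as in
p420303 `statement_of_thm311_of_pinned3_of_pilotKummerCompat`). [claim: Mochizuki2012, status: disputed] -/
theorem statement_of_thm311_of_pinned3_of_subDatum (F : FullSituation T) (P : Cor312.Setting F.toLatticeSituation.toSituation)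
    (ρ : (∀ v : T.V, v ∈ T.Vbad → Set (F.L.StarPacket v)) → ∀ (j : T.Label) (vQ : T.VQ), Set (F.L.Packet j vQ))
    (qK : ∀ v : T.V, v ∈ T.Vbad → Set (F.L.StarPacket v))
    (_hThm : F.Statement) (H : BridgeHyps P)
    (hmono : ∀ (Ψ Ψ' : ∀ v : T.V, v ∈ T.Vbad → Set (F.L.StarPacket v)),
      (∀ (v : T.V) (hv : v ∈ T.Vbad), Ψ v hv ⊆ Ψ' v hv) → ∀ (j : T.Label) (vQ : T.VQ), ρ Ψ j vQ ⊆ ρ Ψ' j vQ)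
    (hpin : PinnedRegions3 F.toLatticeSituation P ρ qK)
    (hsub : ∃ Φ ∈ Subgroup.closure (F.L.Ind1Family ∪ F.L.Ind2Family), ∃ m : ℤ,
      ∀ (v : T.V) (hv : v ∈ T.Vbad), qK v hv ⊆ F.L.starAut Φ v '' (F.toLatticeSituation.col P.n).frobΨ m v hv) :
    P.Statement :=
  statement_of_subDatum F.toLatticeSituation P ρ qK H hmono hpin.1 hsub

/-- With a monotone operator the DATUM (equality) clause gives the HULL clause through the inclusion form — a second route to
p420303's `pilotKummerCompatHull_of_region ∘ pilotKummerCompatRegion_of_pilotKummerCompat`. [folklore] -/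
theorem pilotKummerCompatHull_of_pilotKummerCompat_of_mono
    (hmono : ∀ (Ψ Ψ' : ∀ v : T.V, v ∈ T.Vbad → Set (S.L.StarPacket v)),
      (∀ (v : T.V) (hv : v ∈ T.Vbad), Ψ v hv ⊆ Ψ' v hv) → ∀ (j : T.Label) (vQ : T.VQ), ρ Ψ j vQ ⊆ ρ Ψ' j vQ)
    (hΘ : ThetaPinned S P ρ) (hc : PilotKummerCompat S P qK) : PilotKummerCompatHull S P ρ qK := by
  refine pilotKummerCompatHull_of_subDatum S P ρ qK hmono hΘ ?_
  obtain ⟨Φ, hΦ, m, hm⟩ := hc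
  exact ⟨Φ, hΦ, m, fun v hv => (hm v hv).le⟩

end General

/-! ## 2. The naive model: the honest operator is monotone -/

namespace NaiveWitness

open Cor312.Checks Cor312.IdentifiedNonVacuity GluedMonoids.Naive

variable (p : ℕ) [hp : Fact p.Prime]

omit hp in
/-- **abc-iut-w5-d230's honest operator `ballOfMonoid` is MONOTONE in the datum** (more theta tuples generate a bigger ball): the
hypothesis `hmono` of §1, discharged for the naive model. [folklore] -/
theorem ballOfMonoid_mono :
    ∀ (Ψ Ψ' : ∀ v : toyIndex.V, v ∈ toyIndex.Vbad → Set (signShells.StarPacket v)),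
      (∀ (v : toyIndex.V) (hv : v ∈ toyIndex.Vbad), Ψ v hv ⊆ Ψ' v hv) →
        ∀ (j : toyIndex.Label) (vQ : toyIndex.VQ), ballOfMonoid p Ψ j vQ ⊆ ballOfMonoid p Ψ' j vQ := by
  intro Ψ Ψ' h j vQ
  by_cases hj : j = 0
  · subst hj
    rw [ballOfMonoid_zero, ballOfMonoid_zero]
  · rw [ballOfMonoid_of_ne_zero p _ hj, ballOfMonoid_of_ne_zero p _ hj]
    exact Set.biUnion_subset_biUnion_left (h () trivial)

/-- **In the naive family the INCLUSION form gives typed Cor. 3.12 by the GENERAL route** (§1 with `ballOfMonoid_mono`; every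
`withQDatum` setting carries the pins and the bridge hypotheses) — no residual, no Thm. 3.11 (ii) (b) needed.
[claim: Mochizuki2012, status: disputed] -/
theorem subDatum_imp_statement_naive (qK : ∀ v : toyIndex.V, v ∈ toyIndex.Vbad → Set (signShells.StarPacket v))
    (hqK : ∀ (j : toyIndex.Label) (vQ : toyIndex.VQ), ∃ k : ℤ, pBall p j vQ k = ballOfMonoid p qK j vQ)
    (hsub : ∃ Φ ∈ Subgroup.closure (signShells.Ind1Family ∪ signShells.Ind2Family), ∃ m : ℤ,
      ∀ (v : toyIndex.V) (hv : v ∈ toyIndex.Vbad),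
        qK v hv ⊆ signShells.starAut Φ v '' ((naiveFull p).toLatticeSituation.col (withQDatum p qK hqK).n).frobΨ m v hv) :
    (withQDatum p qK hqK).Statement :=
  statement_of_subDatum (naiveFull p).toLatticeSituation (withQDatum p qK hqK) (ballOfMonoid p) qK
    (withQDatum_bridgeHyps p qK hqK) (ballOfMonoid_mono p) (withQDatum_pinnedRegions p qK hqK) hsub

/-- Non-vacuity of the hypothesis of `subDatum_imp_statement_naive`: at P♭ (`linkIdSetting`, datum `Ψ`) the inclusion form holds
(`Φ = 1`, `m = 0`), so the general route fires there (its conclusion `(linkIdSetting p).Statement` is p420952's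
`linkId_statement_via_pilotKummerCompat`). [folklore] -/
theorem linkId_subDatum :
    ∃ Φ ∈ Subgroup.closure (signShells.Ind1Family ∪ signShells.Ind2Family), ∃ m : ℤ,
      ∀ (v : toyIndex.V) (hv : v ∈ toyIndex.Vbad),
        Psi p v ⊆ signShells.starAut Φ v '' ((naiveFull p).toLatticeSituation.col (linkIdSetting p).n).frobΨ m v hv := by
  refine ⟨1, one_mem _, 0, fun v hv => ?_⟩
  rw [naiveFull_frobΨ, image_Psi_of_actsBySigns p actsBySigns_one]

end NaiveWitness

end Summit.ABC.IUTFork.Cor312Vol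

end
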